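import Summits.HodgeConjecture.HodgeConjecture.Theorems.Ring2HypothesesDescentFiniteEtaleBaseChange
import Summits.HodgeConjecture.HodgeConjecture.Theorems.Ring2HypothesesDescentMotivatedDeformationProjectiveBase
import Literature.AlgebraicGeometry.HodgeTheory.InvariantClassesFromTotalSpaceHolds
import Literature.AlgebraicGeometry.HodgeTheory.FiniteEtaleCoverOfFiniteIndexSmooth
import HarnessLib

/-!
# Ring 2 hypotheses, descent face — ANDRÉ'S COROLLAIRE 5.1 (parallel transports of a motivated class with finite
# monodromy orbit are motivated) OVER SMOOTH PROJECTIVE BASES, IN PARTICULAR ON EVERY COMPACT ABELIAN PENCIL, FACT-FREE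

research route conditional on HC_CM; not a corollary; Q11.4-sentence-2 already refuted in dim ≥ 3.
Cell `pub-hodge-ring2` (Hodge ladder STAGE 3), seat `ring2-b05` (binder row b05
`Ring2.Hypotheses.MotivatedImpliesAlgebraicAV`), gen 43. `HC_CM` (`Theses.RankFourFaces.CMAbelianHodge`) does not occur
in this file; nothing here proves a case of the Hodge conjecture; no binder of `BINDER-OWNERS.md` is discharged.

THE OBSERVATION. The Literature lane's `Andre1996.transportFun_mem_motivatedClasses_of_finiteIndex_compactPencil`
(André 1996, Cor. 5.1 on a compact pencil of abelian varieties) carries TWO named facts as hypotheses: the global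
invariant cycle theorem `deligne_globalInvariantCycles` (c17, Hodge II 4.1.1, not discharged) and the deformation theorem
`Andre1996_deformation` (c24, arbitrary base, not discharged). On a compact pencil — more generally for a smooth
projective family `f : 𝒳 ⟶ S` with smooth projective total space over a smooth projective base — neither is needed:

1. «le sous-groupe d'indice fini définit un revêtement étale `S' → S`» is the tree's THEOREM
   `exists_finiteEtale_of_finiteIndex_of_smooth` (Riemann's existence theorem over smooth bases);
2. the base change `𝒳 ×_S S' ⟶ S'` is again a smooth projective family with smooth projective total space over a
   smooth projective base (gen 43, `isSmoothProjective_familyPullback` / `isSmoothProjective_of_isFinite_of_etale`;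
   for pencils `isCompactAbelianPencil_familyPullback_snd`) — NO compactification `X̄'` is needed («en supposant que
   `𝒱` contienne … une compactification lisse de `X'`»: here `X̄' = X'`);
3. the lift of the `π₁(S')`-invariant class `e^* T` to `H²ᵖ(X'(ℂ); ℂ)` is Deligne 1968 / Voisin II Thm. 4.18, the
   tree's THEOREM `deligne1968_invariantClass_fromTotalSpace_holds` (invariants extend to continuous sections by
   `exists_continuous_section_of_forall_transportFun_eq`) — the partie fixe in its projective-morphism form, not c17;
4. Thm. 0.5 along `X' → S'` is gen 42's THEOREM `map_fiberι_mem_motivatedClasses_of_isSmoothProjective_base`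
   (André's §5.1 over a smooth projective base: (A3) + Deligne's kernel identity + Prop. 2.1 (ii)), not c24;
5. path lifting along the covering `g(ℂ)` and transport of motivated classes along fibre isomorphisms, verbatim as in
   the Literature file.

* §1 `exists_eq_map_fiberι_of_forall_transportFun_eq` — **a monodromy-invariant class on a fibre of a smooth
  projective family with quasi-projective total space over a smooth quasi-projective base with path-connected complex
  points is the restriction of a class of the total space**, fact-free (Deligne 1968 = `…fromTotalSpace_holds` + Voisin
  II Lemma 4.17 = `exists_continuous_section_of_forall_transportFun_eq`).
* §1 (cont.) `exists_motivated_eq_map_fiberι_of_forall_transportFun_eq` — «En fait, `ξ_s` provient d'un cycle motivé sur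
  `X`» (§5.1, last sentence): a π₁-INVARIANT MOTIVATED class on a fibre is the restriction of a MOTIVATED class of the
  (smooth projective) total space — §1 + André's (A3) (gen 36's theorem `Andre1996_exists_motivated_of_motivated_pullback_holds`);
  compact-pencil form `compactPencil_exists_motivated_eq_map_fiberι_of_forall_transportFun_eq`.
* §2 `transportFun_mem_motivatedClasses_of_finiteEtaleCover_of_isSmoothProjective_base` — COR. 5.1 FROM STEP 2 ON, the
  finite étale cover GIVEN, over a smooth projective base: fact-free.
* §3 `transportFun_mem_motivatedClasses_of_finiteIndex_of_isSmoothProjective_base` — COR. 5.1 over a smooth projective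
  base of any dimension, fact-free; `transportFun_toPath_mem_motivatedClasses_of_finiteIndex_of_isSmoothProjective_base`
  («en particulier, pour tout `γ ∈ π₁(S(ℂ), s)`, `γT` est motivé»).
* §4 **`transportFun_mem_motivatedClasses_of_finiteIndex_compactPencil'` — COR. 5.1 ON EVERY COMPACT PENCIL OF ABELIAN
  VARIETIES, UNCONDITIONALLY** (the Literature namesake without `hGIC`, `h05`), and the orbit form
  `transportFun_toPath_mem_motivatedClasses_compactPencil_of_finiteIndex`.

HONEST COLUMN. No definition, no named fact, no sorry. Cor. 5.1 over QUASI-PROJECTIVE bases (André's printed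
generality) still needs c17 / c24 (Hironaka's `X̄'` and Hodge II) and is NOT touched; only the projective-base case —
the one the b05 axis and André's §6.3 use («le théorème 0.5 appliqué au cas particulier d'un pinceau compact») — is
made fact-free, exactly as gen 42 did for Thm. 0.5 itself. The typed `T` is a class of ONE even degree on ONE fibre
(André's `m = 1, n = 0`), `ℂ`-coefficients, as in the Literature file. No Summit row consumes Cor. 5.1 today; the file
closes the André-§5 ledger of the axis over projective bases (Thm. 0.5: gen 42; Cor. 5.1: here).
References: Andre1996Motifs (Cor. 5.1 p. 26, Thm. 0.5 p. 8, §5.1 p. 25, §6.3 p. 33), Deligne1968 ((2.1), (2.6.3)),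
VoisinHodgeII2003 (Lemma 4.17, Thm. 4.18), SGA1 (XII Thm. 5.1, Prop. 2.4), HatcherAT2002 (Prop. 1.30),
Voisin2007HodgeLoci (§3, proof of Prop. 0.7: the same monodromy architecture).
-/

noncomputable section

-- every declaration of this problem lives in `Summit.HodgeConjecture.HodgeConjecture.…` (summit = sub-problem)
set_option linter.dupNamespace false

open CategoryTheory CategoryTheory.Limits AlgebraicGeometry MonoidalCategory
open _root_.Topology
open Literature.AlgebraicTopology.SingularHomology
open Literature.AlgebraicGeometry Literature.AlgebraicGeometry.Motives Literature.AlgebraicGeometry.HodgeTheory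
open Literature.AlgebraicGeometry.Andre1996 (isCohomologicallyLocallyTrivialOn_univ_of_isCompactAbelianPencil)

namespace Summit.HodgeConjecture.HodgeConjecture.Theorems

/-! ## §1 Invariant classes lift to the total space (Deligne 1968), in the transport language -/

/-- **A monodromy-invariant class on a fibre is the restriction of a class of the total space, fact-free.** Let
`f : 𝒳 ⟶ S` be a smooth projective family of relative dimension `n` with quasi-projective total space over a smooth
quasi-projective `S` whose complex points are path connected and locally path connected, `R^k f_* ℂ` a local system in
the sense `hU`, and `α ∈ Hᵏ(X_{s₀}(ℂ); ℂ)` fixed by the monodromy of every loop at `s₀`. Then `α = j_{s₀}^* A` for some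
`A ∈ Hᵏ(𝒳(ℂ); ℂ)`: extend `α` to a continuous section (Voisin II Lemma 4.17, the tree's
`exists_continuous_section_of_forall_transportFun_eq`) and apply Deligne's theorem (Voisin II Thm. 4.18, the tree's
`deligne1968_invariantClass_fromTotalSpace_holds`). [cite: VoisinHodgeII2003, Lemma 4.17 and Thm. 4.18]
[cite: Deligne1968, Prop. (2.1) with (2.6.3)] -/
theorem exists_eq_map_fiberι_of_forall_transportFun_eq {n : ℕ} {𝒳 S : SchemeOver ℂ} (f : 𝒳 ⟶ S)
    (hf : IsSmoothProjectiveFamily f n) (h𝒳 : IsQuasiProjectiveOver 𝒳) (hS : IsQuasiProjectiveOver S)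
    (hSs : Smooth S.hom) (hU : IsCohomologicallyLocallyTrivialOn f (Set.univ : Set (ComplexPoints S)))
    [PathConnectedSpace (ComplexPoints S)] [LocallyPathConnectedSpace (ComplexPoints S)]
    (k : ℕ) (s₀ : ComplexPoints S) (α : complexBetti (fiberOver f s₀) k)
    (hinv : ∀ γ : Path.Homotopic.Quotient
        (⟨s₀, Set.mem_univ s₀⟩ : (Set.univ : Set (ComplexPoints S))) ⟨s₀, Set.mem_univ s₀⟩,
      transportFun f k hU γ α = α) :
    ∃ A : complexBetti 𝒳 k, α = complexBetti.map (fiberι f s₀) k A := by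
  obtain ⟨σ, hσ, hpt, h₀⟩ := exists_continuous_section_of_forall_transportFun_eq f k hU s₀ α hinv
  obtain ⟨A, hA⟩ := deligne1968_invariantClass_fromTotalSpace_holds 𝒳 S f n hf h𝒳 hS hSs k σ hσ hpt s₀
  refine ⟨A, ?_⟩
  rw [h₀] at hA
  exact (FiberClass.mk_eq_mk_iff _ _).1 hA

/-- **André, §5.1, last sentence — «En fait, `ξ_s` provient d'un cycle motivé sur `X`» — over a smooth projective base,
fact-free: a MOTIVATED class on a fibre invariant under the monodromy of every loop is the restriction of a MOTIVATED class
of the total space.** For `f : 𝒳 ⟶ S` a smooth projective family of relative dimension `n` with smooth projective total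
`N`-fold over a smooth quasi-projective base with path-connected, locally path-connected complex points: §1 lifts the
class to some `A ∈ H²ᵖ(𝒳(ℂ); ℂ)` (Deligne 1968), and André's (A3) — the tree's theorem
`Andre1996_exists_motivated_of_motivated_pullback_holds` (gen 36: Thm. 0.4 + Prop. 3.3) — replaces `A` by a motivated
`A'` with the same restriction. [cite: Andre1996Motifs, §5.1 (p. 25) and Thm. 0.4 (p. 8)] [cite: VoisinHodgeII2003, Thm. 4.18] -/
theorem exists_motivated_eq_map_fiberι_of_forall_transportFun_eq {n N : ℕ} {𝒳 S : SchemeOver ℂ} (f : 𝒳 ⟶ S)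
    (hf : IsSmoothProjectiveFamily f n) (h𝒳 : IsSmoothProjective N 𝒳) (hS : IsQuasiProjectiveOver S)
    (hSs : Smooth S.hom) (hU : IsCohomologicallyLocallyTrivialOn f (Set.univ : Set (ComplexPoints S)))
    [PathConnectedSpace (ComplexPoints S)] [LocallyPathConnectedSpace (ComplexPoints S)]
    (p : ℕ) (s₀ : ComplexPoints S) (α : complexBetti (fiberOver f s₀) (2 * p))
    (hα : α ∈ motivatedClasses n (fiberOver f s₀) p)
    (hinv : ∀ γ : Path.Homotopic.Quotient
        (⟨s₀, Set.mem_univ s₀⟩ : (Set.univ : Set (ComplexPoints S))) ⟨s₀, Set.mem_univ s₀⟩,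
      transportFun f (2 * p) hU γ α = α) :
    ∃ A' ∈ motivatedClasses N 𝒳 p, complexBetti.map (fiberι f s₀) (2 * p) A' = α := by
  obtain ⟨A, hA⟩ := exists_eq_map_fiberι_of_forall_transportFun_eq f hf
    (IsQuasiProjectiveOver.of_isProjectiveOver h𝒳.isProjectiveOver) hS hSs hU (2 * p) s₀ α hinv
  obtain ⟨A', hA', hj⟩ := Andre1996_exists_motivated_of_motivated_pullback_holds (fiberι f s₀) h𝒳
    (hf.isSmoothProjective s₀) p A (hA ▸ hα)
  exact ⟨A', hA', hj.trans hA.symm⟩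

/-- **On a compact pencil of abelian varieties: a motivated class on a fibre fixed by the whole monodromy group is the
restriction of a motivated class of the total space, unconditionally** (the pencil case of the previous row; the
local-system witness is Ehresmann's, `isCohomologicallyLocallyTrivialOn_univ_of_isCompactAbelianPencil`).
[cite: Andre1996Motifs, §5.1 (p. 25) and §6.3 (p. 33)] -/
theorem compactPencil_exists_motivated_eq_map_fiberι_of_forall_transportFun_eq {d : ℕ} {𝒳 S : SchemeOver ℂ}
    {f : 𝒳 ⟶ S} (hf : IsCompactAbelianPencil f d)
    (p : ℕ) (s₀ : ComplexPoints S) (α : complexBetti (fiberOver f s₀) (2 * p))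
    (hα : α ∈ motivatedClasses d (fiberOver f s₀) p)
    (hinv : ∀ γ : Path.Homotopic.Quotient
        (⟨s₀, Set.mem_univ s₀⟩ : (Set.univ : Set (ComplexPoints S))) ⟨s₀, Set.mem_univ s₀⟩,
      transportFun f (2 * p) (isCohomologicallyLocallyTrivialOn_univ_of_isCompactAbelianPencil hf) γ α = α) :
    ∃ A' ∈ motivatedClasses (d + 1) 𝒳 p, complexBetti.map (fiberι f s₀) (2 * p) A' = α := by
  -- `S(ℂ)` is a connected Riemann surface: path connected and locally path connected
  haveI := hf.isSmoothProjective_base.smoothOfRelativeDimension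
  have hSqp : IsQuasiProjectiveOver S := IsQuasiProjectiveOver.of_isProjectiveOver hf.isSmoothProjective_base.isProjectiveOver
  haveI : LocallyOfFiniteType S.hom := hSqp.locallyOfFiniteType
  haveI : ConnectedSpace (ComplexPoints S) := connectedSpace_complexPoints hf.isSmoothProjective_base
  letI := Motives.ComplexPoints.chartedSpace S 1
  haveI : LocallyPathConnectedSpace (ComplexPoints S) :=
    ChartedSpace.locallyPathConnectedSpace (EuclideanSpace ℝ (Fin (2 * 1))) _
  haveI : PathConnectedSpace (ComplexPoints S) := pathConnectedSpace_iff_connectedSpace.mpr ‹_›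
  exact exists_motivated_eq_map_fiberι_of_forall_transportFun_eq f hf.isSmoothProjectiveFamily
    hf.isSmoothProjective_total hSqp (SmoothOfRelativeDimension.smooth 1 _) _ p s₀ α hα hinv

/-! ## §2 Cor. 5.1 from step 2 on, the finite étale cover given, over a smooth projective base — fact-free -/

/-- **André 1996, Cor. 5.1 — the proof from step 2 on, with the finite étale cover of step 1 GIVEN AS DATA, over a
SMOOTH PROJECTIVE base, fact-free.** Let `f : 𝒳 ⟶ S` be a smooth projective family of relative dimension `n` whose total
space is a smooth projective `(n+m)`-fold, over a smooth projective `m`-fold `S`; `g : S' ⟶ S` finite étale with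
`S'(ℂ)` path connected, `s' ∈ S'(ℂ)`; `T ∈ A_motᵖ(X_{g s'})_ℂ` a motivated class fixed by the monodromy of the image
under `g(ℂ)` of EVERY loop of `S'(ℂ)` at `s'`. Then every parallel transport of `T` to any `t ∈ S(ℂ)` is motivated.
Steps (module docstring): base change to `S'` (a smooth projective family with smooth projective total space over the
smooth projective `S'`, gen 43 §1–§2); the transfer `e^* T` is `π₁(S'(ℂ), s')`-invariant
(`forall_transportFun_familyPullback_eq`) hence lifts to `A₁ ∈ H²ᵖ(X'(ℂ); ℂ)` (§1, Deligne 1968 — no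
compactification); Thm. 0.5 over the smooth projective base `S'` (gen 42) makes every `A₁|_{X'_{t'}}` motivated; a path
from `g s'` to `t` lifts to `S'(ℂ)` and transport along it is the transfer of `A₁|_{X'_{t'}}`.
[cite: Andre1996Motifs, Cor. 5.1 and its proof (p. 26); Thm. 0.5 (p. 8); §5.1 (p. 25)]
[cite: VoisinHodgeII2003, Lemma 4.17 and Thm. 4.18] [cite: HatcherAT2002, §1.3 Prop. 1.30] -/
theorem transportFun_mem_motivatedClasses_of_finiteEtaleCover_of_isSmoothProjective_base
    {n m : ℕ} {𝒳 S : SchemeOver ℂ} (f : 𝒳 ⟶ S) (hS : IsSmoothProjective m S) (hf : IsSmoothProjectiveFamily f n)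
    (h𝒳 : IsSmoothProjective (n + m) 𝒳)
    (hU : IsCohomologicallyLocallyTrivialOn f (Set.univ : Set (ComplexPoints S)))
    {S' : SchemeOver ℂ} (g : S' ⟶ S) [IsFinite g.left] [Etale g.left]
    [PathConnectedSpace (ComplexPoints S')] (s' : ComplexPoints S')
    {p : ℕ} {T : complexBetti (fiberOver f (AlgPoints.map g s')) (2 * p)}
    (hT : T ∈ motivatedClasses n (fiberOver f (AlgPoints.map g s')) p)
    (hinv : ∀ γ' : Path (⟨s', Set.mem_univ s'⟩ : (Set.univ : Set (ComplexPoints S')))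
        ⟨s', Set.mem_univ s'⟩,
      transportFun f (2 * p) hU
        (s := ⟨AlgPoints.map g s', Set.mem_univ _⟩) (t := ⟨AlgPoints.map g s', Set.mem_univ _⟩)
        ⟦γ'.map ((((AlgPoints.continuous_map g).comp continuous_subtype_val)).subtype_mk
          fun _ ↦ Set.mem_univ _)⟧ T = T)
    (t : ComplexPoints S)
    (γ : Path.Homotopic.Quotient
      (⟨AlgPoints.map g s', Set.mem_univ _⟩ : (Set.univ : Set (ComplexPoints S))) ⟨t, Set.mem_univ t⟩) :
    transportFun f (2 * p) hU γ T ∈ motivatedClasses n (fiberOver f t) p := by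
  -- adapted from Literature/AlgebraicGeometry/Andre1996/MonodromyInvariantMotivatedClasses.lean (steps 2, 5 verbatim;
  -- steps 3–4 replaced by the fact-free projective-base theorems)
  -- Step 0: the base `S` is smooth of pure dimension `m`, quasi-projective, irreducible, separated, locally of finite type
  haveI := hS.smoothOfRelativeDimension
  have hSqp : IsQuasiProjectiveOver S := IsQuasiProjectiveOver.of_isProjectiveOver hS.isProjectiveOver
  haveI : LocallyOfFiniteType S.hom := hSqp.locallyOfFiniteType
  haveI : IsSeparated S.hom := hSqp.isVarietyPair_ofScheme.isSeparated
  haveI : IrreducibleSpace S.left := hS.irreducibleSpace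
  -- the cover `S'`: a smooth projective `m`-fold (gen 43 §1); `g(ℂ)` a local homeomorphism and a covering map
  have hS' : IsSmoothProjective m S' := isSmoothProjective_of_isFinite_of_etale hS g
  haveI hS'd : SmoothOfRelativeDimension m S'.hom := hS'.smoothOfRelativeDimension
  haveI : AlgebraicGeometry.Smooth S'.hom := SmoothOfRelativeDimension.smooth m _
  have hS'qp : IsQuasiProjectiveOver S' := IsQuasiProjectiveOver.of_isProjectiveOver hS'.isProjectiveOver
  haveI : LocallyOfFiniteType S'.hom := hS'qp.locallyOfFiniteType
  haveI : IsSeparated S'.hom := hS'qp.isVarietyPair_ofScheme.isSeparated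
  haveI : QuasiCompact S'.hom := hS'qp.isVarietyPair_ofScheme.quasiCompact
  letI := Motives.ComplexPoints.chartedSpace S' m
  haveI : LocallyPathConnectedSpace (ComplexPoints S') :=
    ChartedSpace.locallyPathConnectedSpace (EuclideanSpace ℝ (Fin (2 * m))) _
  have hgloc : IsLocalHomeomorph (AlgPoints.map g : ComplexPoints S' → ComplexPoints S) :=
    Motives.ComplexPoints.isLocalHomeomorph_map m _
  have hgcov : IsCoveringMap (AlgPoints.map g : ComplexPoints S' → ComplexPoints S) :=
    (Motives.ComplexPoints.isCoveringMap_map_of_isFinite m g).1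
  -- Step 2 (base change «`X' := X ×_S S' → S'`»): the family `π'`, a smooth projective family with smooth projective
  -- total space over the smooth projective `S'` (gen 43 §2); its local system; the transfer `e^* T`, invariant under
  -- ALL loops at `s'`
  set π' := familyPullback.snd f g
  have hf' : IsSmoothProjectiveFamily π' n := hf.familyPullback_snd g
  have hX' : IsSmoothProjective (n + m) (familyPullback f g) :=
    isSmoothProjective_familyPullback hS hf h𝒳.isProjectiveOver g
  have hX'qp : IsQuasiProjectiveOver (familyPullback f g) := IsQuasiProjectiveOver.of_isProjectiveOver hX'.isProjectiveOver
  have hU' := isCohomologicallyLocallyTrivialOn_univ_of_isSmoothProjectiveFamily π' m hf' hS'qp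
  have hα : (FiberClass.baseChange f g (2 * p)
      ⟨s', complexBetti.map (fiberOverFamilyPullbackIso f g s').hom (2 * p) T⟩).cls = T :=
    FiberClass.cls_baseChange_map_hom _ _ _ s' T
  have h₀' : (⟨(⟨AlgPoints.map g s', Set.mem_univ _⟩ : (Set.univ : Set (ComplexPoints S))).1, T⟩ :
        FiberClass f (2 * p)) =
      FiberClass.baseChange f g (2 * p)
        ⟨s', complexBetti.map (fiberOverFamilyPullbackIso f g s').hom (2 * p) T⟩ := by
    conv_lhs => rw [← hα]
    rfl
  have hinv' := forall_transportFun_familyPullback_eq f g (2 * p) hgloc hU hU' s'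
    (complexBetti.map (fiberOverFamilyPullbackIso f g s').hom (2 * p) T) hα hinv
  -- Step 3 (partie fixe, Deligne 1968, on `X'` itself — no compactification): `e^* T = A₁|_{X'_{s'}}`
  obtain ⟨A₁, hA'⟩ := exists_eq_map_fiberι_of_forall_transportFun_eq π' hf' hX'qp hS'qp
    (SmoothOfRelativeDimension.smooth m _) hU' (2 * p) s'
    (complexBetti.map (fiberOverFamilyPullbackIso f g s').hom (2 * p) T) hinv'
  -- Step 4 (Thm. 0.5 over the smooth projective base `S'`, gen 42): every `A₁|_{X'_{t'}}` is motivated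
  have h₀ : complexBetti.map (fiberι π' s') (2 * p) A₁ ∈ motivatedClasses n (fiberOver π' s') p := by
    rw [← hA']
    exact map_mem_motivatedClasses_of_iso (hf.isSmoothProjective _) (hf'.isSmoothProjective s')
      (fiberOverFamilyPullbackIso f g s') hT
  have hmot : ∀ t' : ComplexPoints S',
      complexBetti.map (fiberι π' t') (2 * p) A₁ ∈ motivatedClasses n (fiberOver π' t') p :=
    map_fiberι_mem_motivatedClasses_of_isSmoothProjective_base hS' hf' hX' p A₁ s' h₀
  -- Step 5 («transport parallèle en un point quelconque de `S(ℂ)`»): lift `γ` to `S'(ℂ)` from `s'`; transport along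
  -- `γ` is the transfer of transport along the lift, i.e. of `A₁|_{X'_{t'}}`
  induction γ using Quotient.ind with | _ γ =>
  obtain ⟨t', γ', hγ'⟩ := exists_path_lift_of_isCoveringMapOn
    ((isCoveringMap_iff_isCoveringMapOn_univ).1 hgcov) (γ.map continuous_subtype_val)
    (fun _ ↦ Set.mem_univ _) s' rfl
  let ιS' : ComplexPoints S' → (Set.univ : Set (ComplexPoints S')) := fun x ↦ ⟨x, Set.mem_univ x⟩
  have hιS' : Continuous ιS' := continuous_id.subtype_mk _
  have hcomp := FiberClass.baseChange_transportFun f g (2 * p) hgloc hU hU' γ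
    (s' := ιS' s') (t' := ιS' t') (γ'.map hιS') (fun u ↦ hγ' u)
    (complexBetti.map (fiberOverFamilyPullbackIso f g s').hom (2 * p) T) h₀'
  have hup : transportFun π' (2 * p) hU' (s := ιS' s') (t := ιS' t') ⟦γ'.map hιS'⟧
        (complexBetti.map (fiberOverFamilyPullbackIso f g s').hom (2 * p) T) =
      complexBetti.map (fiberι π' t') (2 * p) A₁ := by
    rw [hA']
    exact transportFun_map_fiberι π' (2 * p) hU' _ A₁
  rw [hup] at hcomp
  have hfin := map_mem_motivatedClasses_of_iso (hf'.isSmoothProjective t') (hf.isSmoothProjective _)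
    (fiberOverFamilyPullbackIso f g t').symm (hmot t')
  exact (FiberClass.prop_iff_of_mk_eq (fun u x ↦ x ∈ motivatedClasses n (fiberOver f u) p) hcomp).2 hfin

/-! ## §3 Cor. 5.1 over a smooth projective base, finite-index form — fact-free -/

/-- **André 1996, Cor. 5.1 over a SMOOTH PROJECTIVE base (any dimension), UNCONDITIONALLY.** Let `f : 𝒳 ⟶ S` be a
smooth projective family of relative dimension `n` with smooth projective total `(n+m)`-fold over a smooth projective
`m`-fold `S`; `s ∈ S(ℂ)`; `T ∈ A_motᵖ(X_s)_ℂ` a motivated class fixed by the monodromy of a finite-index subgroup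
`H ≤ π₁(S(ℂ), s)`. Then for every `t ∈ S(ℂ)` and every homotopy class of paths `γ` from `s` to `t`, the parallel
transport `γ_* T` is motivated («les translatés de `T` par transport parallèle en un point quelconque de `S(ℂ)` sont
motivés»). Step 1 is Riemann's existence theorem over the smooth quasi-projective `S`, the tree's theorem
`exists_finiteEtale_of_finiteIndex_of_smooth`; steps 2–5 are §2. No named fact.
[cite: Andre1996Motifs, Cor. 5.1 and its proof (p. 26)] [cite: SGA1, Exp. XII Thm. 5.1] -/
theorem transportFun_mem_motivatedClasses_of_finiteIndex_of_isSmoothProjective_base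
    {n m : ℕ} {𝒳 S : SchemeOver ℂ} (f : 𝒳 ⟶ S) (hS : IsSmoothProjective m S) (hf : IsSmoothProjectiveFamily f n)
    (h𝒳 : IsSmoothProjective (n + m) 𝒳)
    (hU : IsCohomologicallyLocallyTrivialOn f (Set.univ : Set (ComplexPoints S)))
    {s : ComplexPoints S} {p : ℕ} {T : complexBetti (fiberOver f s) (2 * p)}
    (hT : T ∈ motivatedClasses n (fiberOver f s) p)
    (H : Subgroup (FundamentalGroup (Set.univ : Set (ComplexPoints S)) ⟨s, Set.mem_univ s⟩))
    [H.FiniteIndex]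
    (hH : ∀ γ ∈ H, transportFun f (2 * p) hU (FundamentalGroup.toPath γ) T = T)
    (t : ComplexPoints S)
    (γ : Path.Homotopic.Quotient (⟨s, Set.mem_univ s⟩ : (Set.univ : Set (ComplexPoints S)))
      ⟨t, Set.mem_univ t⟩) :
    transportFun f (2 * p) hU γ T ∈ motivatedClasses n (fiberOver f t) p := by
  haveI := hS.smoothOfRelativeDimension
  haveI : AlgebraicGeometry.Smooth S.hom := SmoothOfRelativeDimension.smooth m _
  haveI : IrreducibleSpace S.left := hS.irreducibleSpace
  have hSqp : IsQuasiProjectiveOver S := IsQuasiProjectiveOver.of_isProjectiveOver hS.isProjectiveOver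
  -- Step 1 («le sous-groupe d'indice fini définit un revêtement étale `S' → S`»): Riemann existence over the smooth `S`
  obtain ⟨S', g, s', hs, hgfin, hget, hS'pc, hloops⟩ :=
    exists_finiteEtale_of_finiteIndex_of_smooth S hSqp s H
  subst hs
  haveI := hgfin
  haveI := hget
  haveI := hS'pc
  -- Steps 2–5
  exact transportFun_mem_motivatedClasses_of_finiteEtaleCover_of_isSmoothProjective_base f hS hf h𝒳 hU g s' hT
    (fun γ' ↦ hH _ (hloops γ')) t γ

/-- **«En particulier, pour tout `γ ∈ π₁(S(ℂ), s)`, `γT` est motivé»** — over a smooth projective base, fact-free: under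
the hypotheses of `transportFun_mem_motivatedClasses_of_finiteIndex_of_isSmoothProjective_base`, the monodromy image of
`T` under EVERY element of the fundamental group (not only of `H`) is motivated. [cite: Andre1996Motifs, Cor. 5.1 (p. 26)] -/
theorem transportFun_toPath_mem_motivatedClasses_of_finiteIndex_of_isSmoothProjective_base
    {n m : ℕ} {𝒳 S : SchemeOver ℂ} (f : 𝒳 ⟶ S) (hS : IsSmoothProjective m S) (hf : IsSmoothProjectiveFamily f n)
    (h𝒳 : IsSmoothProjective (n + m) 𝒳)
    (hU : IsCohomologicallyLocallyTrivialOn f (Set.univ : Set (ComplexPoints S)))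
    {s : ComplexPoints S} {p : ℕ} {T : complexBetti (fiberOver f s) (2 * p)}
    (hT : T ∈ motivatedClasses n (fiberOver f s) p)
    (H : Subgroup (FundamentalGroup (Set.univ : Set (ComplexPoints S)) ⟨s, Set.mem_univ s⟩))
    [H.FiniteIndex]
    (hH : ∀ γ ∈ H, transportFun f (2 * p) hU (FundamentalGroup.toPath γ) T = T)
    (γ : FundamentalGroup (Set.univ : Set (ComplexPoints S)) ⟨s, Set.mem_univ s⟩) :
    transportFun f (2 * p) hU (FundamentalGroup.toPath γ) T ∈ motivatedClasses n (fiberOver f s) p :=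
  transportFun_mem_motivatedClasses_of_finiteIndex_of_isSmoothProjective_base f hS hf h𝒳 hU hT H hH s
    (FundamentalGroup.toPath γ)

/-! ## §4 Cor. 5.1 on every compact pencil of abelian varieties — unconditionally -/

/-- **André 1996, Cor. 5.1 ON A COMPACT PENCIL OF ABELIAN VARIETIES, UNCONDITIONALLY** — the Literature lane's
`Andre1996.transportFun_mem_motivatedClasses_of_finiteIndex_compactPencil` with BOTH named facts (`hGIC` = c17,
`h05` = c24) removed: for `f : 𝒳 ⟶ S` a compact pencil of abelian `d`-folds (`IsCompactAbelianPencil f d`), every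
parallel transport of a motivated class `T ∈ A_motᵖ(X_s)_ℂ` fixed by a finite-index subgroup of `π₁(S(ℂ), s)` is
motivated. (Base a smooth projective curve, total space a smooth projective `(d+1)`-fold: §3 with `m = 1`.)
[cite: Andre1996Motifs, Cor. 5.1 (p. 26) and §6.3 (p. 33)] [cite: VoisinHodgeII2003, Thm. 4.18] -/
theorem transportFun_mem_motivatedClasses_of_finiteIndex_compactPencil'
    {d : ℕ} {𝒳 S : SchemeOver ℂ} {f : 𝒳 ⟶ S} (hf : IsCompactAbelianPencil f d)
    (hU : IsCohomologicallyLocallyTrivialOn f (Set.univ : Set (ComplexPoints S)))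
    {s : ComplexPoints S} {p : ℕ} {T : complexBetti (fiberOver f s) (2 * p)}
    (hT : T ∈ motivatedClasses d (fiberOver f s) p)
    (H : Subgroup (FundamentalGroup (Set.univ : Set (ComplexPoints S)) ⟨s, Set.mem_univ s⟩))
    [H.FiniteIndex]
    (hH : ∀ γ ∈ H, transportFun f (2 * p) hU (FundamentalGroup.toPath γ) T = T)
    (t : ComplexPoints S)
    (γ : Path.Homotopic.Quotient (⟨s, Set.mem_univ s⟩ : (Set.univ : Set (ComplexPoints S)))
      ⟨t, Set.mem_univ t⟩) :
    transportFun f (2 * p) hU γ T ∈ motivatedClasses d (fiberOver f t) p :=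
  transportFun_mem_motivatedClasses_of_finiteIndex_of_isSmoothProjective_base f hf.isSmoothProjective_base
    hf.isSmoothProjectiveFamily hf.isSmoothProjective_total hU hT H hH t γ

/-- **The orbit form on a compact pencil, with the local-system witness supplied**: for a compact pencil of abelian
`d`-folds, a motivated class `T ∈ A_motᵖ(X_s)_ℂ` with stabiliser of finite index in `π₁(S(ℂ), s)` has its whole
monodromy orbit inside `A_motᵖ(X_s)_ℂ` — «pour tout `γ ∈ π₁(S(ℂ), s)`, `γT` est motivé» — unconditionally; the local
system witness is `isCohomologicallyLocallyTrivialOn_univ_of_isCompactAbelianPencil` (Ehresmann).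
[cite: Andre1996Motifs, Cor. 5.1 (p. 26)] [cite: VoisinHodgeI2002, Thm. 9.3] -/
theorem transportFun_toPath_mem_motivatedClasses_compactPencil_of_finiteIndex
    {d : ℕ} {𝒳 S : SchemeOver ℂ} {f : 𝒳 ⟶ S} (hf : IsCompactAbelianPencil f d)
    {s : ComplexPoints S} {p : ℕ} {T : complexBetti (fiberOver f s) (2 * p)}
    (hT : T ∈ motivatedClasses d (fiberOver f s) p)
    (H : Subgroup (FundamentalGroup (Set.univ : Set (ComplexPoints S)) ⟨s, Set.mem_univ s⟩))
    [H.FiniteIndex]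
    (hH : ∀ γ ∈ H, transportFun f (2 * p) (isCohomologicallyLocallyTrivialOn_univ_of_isCompactAbelianPencil hf)
      (FundamentalGroup.toPath γ) T = T)
    (γ : FundamentalGroup (Set.univ : Set (ComplexPoints S)) ⟨s, Set.mem_univ s⟩) :
    transportFun f (2 * p) (isCohomologicallyLocallyTrivialOn_univ_of_isCompactAbelianPencil hf)
      (FundamentalGroup.toPath γ) T ∈ motivatedClasses d (fiberOver f s) p :=
  transportFun_mem_motivatedClasses_of_finiteIndex_compactPencil' hf _ hT H hH s (FundamentalGroup.toPath γ)

end Summit.HodgeConjecture.HodgeConjecture.Theorems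

end
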